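import Mathlib
import Summits.AtomisticToContinuum.BoseEinsteinCondensation.Theorems.SoloBlindSymmetrisedJensen

/-!
# The spin-wave half of the Fröhlich–Spencer lower bound needs no Gaussian structure
(solo paper §13.9, scope note for the Hamiltonian / time-blocked rotor model)

In the dual (field-strength) representation of a `D ≥ 3` abelian lattice model the two-point
function is a ratio `Z(S)/Z` in which the disorder 1-form `E_S` (the coexact spreading of the
string `S`, `‖E_S‖² = 2(2π)²(G(0) - G(x-y)) < ∞` in `D ≥ 3`) shifts the argument of the action:
`Z(S)/Z = ⟨exp(-(A(u - E_S) - A(u)))⟩`.  For the Villain model `A` is quadratic and the bound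
`Z(S)/Z ≥ exp(-‖E_S‖²/2β)` is a Gaussian computation.  Recorded here: for ANY action `A` whose
curvature along a linear map `L` is bounded above by `C` — precisely, `x ↦ C/2 ‖L x‖² - A x` is
convex — and ANY probability measure on configurations (even or not), the symmetrised expectation
obeys the same bound with `β⁻¹` replaced by `C`:

  `(⟨e^{-(A(u-e)-A(u))}⟩ + ⟨e^{-(A(u+e)-A(u))}⟩)/2 ≥ exp(-C ‖L e‖²/2)`.

The two expectations are the observable and its complex conjugate (time reversal), which agree
for a real ground state; the odd (first-order) terms cancel exactly between them and `cosh ≥ 1`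
does the rest (`exp_le_half_integral_add_integral` of `SoloBlindSymmetrisedJensen`).  This is the
form needed for quasi-local, non-product, non-Gaussian weights (time-blocked quantum rotor:
Bessel/Skellam spatial weights, Villain temporal weights with offset charge, positive intra-block
corrections), cell by cell (`Finset` version).

* `second_diff_le_of_convexOn` — convexity of `C/2‖L·‖² - A` gives
  `A(u+e) + A(u-e) - 2A(u) ≤ C‖L e‖²` (parallelogram law);
* `sum_second_diff_le` — the cell-wise (quasi-local) version;
* `exp_neg_half_le_half_integral_add_of_second_diff_le` — the symmetrised Jensen bound from a
  uniform second-difference bound `K`;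
* `exp_neg_half_curv_le_half_integral_add` / `exp_neg_half_sum_curv_le_half_integral_add` — the
  packaged statements for one semiconcavity datum `(L, C)` and for a finite family of cells.
-/

namespace Summit.AtomisticToContinuum.BoseEinsteinCondensation.Theorems

open MeasureTheory

section Semiconvex

variable {E F : Type*} [NormedAddCommGroup E] [InnerProductSpace ℝ E]
  [NormedAddCommGroup F] [InnerProductSpace ℝ F]

/-- Parallelogram law with squares. -/
theorem norm_add_sq_add_norm_sub_sq_eq (x y : F) :
    ‖x + y‖ ^ 2 + ‖x - y‖ ^ 2 = 2 * ‖x‖ ^ 2 + 2 * ‖y‖ ^ 2 := by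
  have h := parallelogram_law_with_norm ℝ x y
  simp only [sq]
  linarith

/-- **Curvature bounded above ⇒ symmetric second differences bounded.** If
`x ↦ C/2 ‖L x‖² - A x` is convex on a real inner product space (for smooth `A`: the Hessian of
`A` is at most `C Lᵀ L`), then `A(u+e) + A(u-e) - 2 A(u) ≤ C ‖L e‖²` for all `u, e`. -/
theorem second_diff_le_of_convexOn (A : E → ℝ) (L : E →ₗ[ℝ] F) (C : ℝ)
    (hA : ConvexOn ℝ Set.univ (fun x => C / 2 * ‖L x‖ ^ 2 - A x)) (u e : E) :
    A (u + e) + A (u - e) - 2 * A u ≤ C * ‖L e‖ ^ 2 := by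
  have h := hA.2 (Set.mem_univ (u + e)) (Set.mem_univ (u - e))
    (show (0 : ℝ) ≤ 1 / 2 by norm_num) (show (0 : ℝ) ≤ 1 / 2 by norm_num)
    (show (1 / 2 : ℝ) + 1 / 2 = 1 by norm_num)
  have hmid : (1 / 2 : ℝ) • (u + e) + (1 / 2 : ℝ) • (u - e) = u := by
    rw [← smul_add, show (u + e) + (u - e) = (2 : ℝ) • u by rw [two_smul]; abel, smul_smul]
    norm_num
  dsimp only at h
  rw [hmid] at h
  simp only [smul_eq_mul, map_add, map_sub] at h
  have hpar := norm_add_sq_add_norm_sub_sq_eq (L u) (L e)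
  have key : C / 2 * ‖L u + L e‖ ^ 2 + C / 2 * ‖L u - L e‖ ^ 2
      = C * ‖L u‖ ^ 2 + C * ‖L e‖ ^ 2 := by
    rw [← mul_add, hpar]
    ring
  linarith

/-- **Cell-wise (quasi-local) version.** A finite sum of terms, each with curvature bounded by
`C i` along `L i`, has symmetric second differences bounded by `∑ C i ‖L i e‖²`. -/
theorem sum_second_diff_le {ι : Type*} (s : Finset ι) (A : ι → E → ℝ) (L : ι → (E →ₗ[ℝ] F))
    (C : ι → ℝ) (hA : ∀ i ∈ s, ConvexOn ℝ Set.univ (fun x => C i / 2 * ‖L i x‖ ^ 2 - A i x))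
    (u e : E) :
    (∑ i ∈ s, A i (u + e)) + (∑ i ∈ s, A i (u - e)) - 2 * ∑ i ∈ s, A i u
      ≤ ∑ i ∈ s, C i * ‖L i e‖ ^ 2 := by
  have hpt : ∀ i ∈ s, A i (u + e) + A i (u - e) - 2 * A i u ≤ C i * ‖L i e‖ ^ 2 :=
    fun i hi => second_diff_le_of_convexOn (A i) (L i) (C i) (hA i hi) u e
  calc (∑ i ∈ s, A i (u + e)) + (∑ i ∈ s, A i (u - e)) - 2 * ∑ i ∈ s, A i u
      = ∑ i ∈ s, (A i (u + e) + A i (u - e) - 2 * A i u) := by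
        rw [Finset.mul_sum, ← Finset.sum_add_distrib, ← Finset.sum_sub_distrib]
    _ ≤ ∑ i ∈ s, C i * ‖L i e‖ ^ 2 := Finset.sum_le_sum hpt

end Semiconvex

section SpinWave

variable {Ω : Type*} [MeasurableSpace Ω] {μ : Measure Ω} [IsProbabilityMeasure μ]
variable {E : Type*} [AddCommGroup E]

/-- **Symmetrised Jensen from a uniform second-difference bound.** For any action `A` on an
additive group with `A(v+e) + A(v-e) - 2A(v) ≤ K` for all `v`, any random configuration `u` and
any probability law, the average of `⟨exp(-(A(u-e)-A(u)))⟩` and `⟨exp(-(A(u+e)-A(u)))⟩` is at least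
`exp(-K/2)`.  No evenness of the law and no Gaussian structure is used. -/
theorem exp_neg_half_le_half_integral_add_of_second_diff_le (A : E → ℝ) (e : E) (K : ℝ)
    (hK : ∀ v, A (v + e) + A (v - e) - 2 * A v ≤ K) (u : Ω → E)
    (hfm : Integrable (fun ω => Real.exp (-(A (u ω - e) - A (u ω)))) μ)
    (hgm : Integrable (fun ω => Real.exp (-(A (u ω + e) - A (u ω)))) μ)
    (hf : Integrable (fun ω => -(A (u ω - e) - A (u ω))) μ)
    (hg : Integrable (fun ω => -(A (u ω + e) - A (u ω))) μ) :
    Real.exp (-(K / 2)) ≤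
      ((∫ ω, Real.exp (-(A (u ω - e) - A (u ω))) ∂μ)
        + ∫ ω, Real.exp (-(A (u ω + e) - A (u ω))) ∂μ) / 2 := by
  set f : Ω → ℝ := fun ω => Real.exp (-(A (u ω - e) - A (u ω))) with hfdef
  set g : Ω → ℝ := fun ω => Real.exp (-(A (u ω + e) - A (u ω))) with hgdef
  have hlogf : (fun ω => Real.log (f ω)) = fun ω => -(A (u ω - e) - A (u ω)) := by
    funext ω
    simp [hfdef, Real.log_exp]
  have hlogg : (fun ω => Real.log (g ω)) = fun ω => -(A (u ω + e) - A (u ω)) := by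
    funext ω
    simp [hgdef, Real.log_exp]
  have hlf : Integrable (fun ω => Real.log (f ω)) μ := by rw [hlogf]; exact hf
  have hlg : Integrable (fun ω => Real.log (g ω)) μ := by rw [hlogg]; exact hg
  have hsum : -K ≤ (∫ ω, Real.log (f ω) ∂μ) + ∫ ω, Real.log (g ω) ∂μ := by
    have hpt : (fun _ : Ω => -K) ≤ fun ω => Real.log (f ω) + Real.log (g ω) := by
      intro ω
      have h1 := hK (u ω)
      simp only [hfdef, hgdef, Real.log_exp]
      linarith
    have hmono := integral_mono (integrable_const (-K)) (hlf.add hlg) hpt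
    have hadd : ∫ x, ((fun ω => Real.log (f ω)) + fun ω => Real.log (g ω)) x ∂μ
        = (∫ ω, Real.log (f ω) ∂μ) + ∫ ω, Real.log (g ω) ∂μ := integral_add hlf hlg
    have hconst : ∫ _x : Ω, -K ∂μ = -K := by simp
    linarith [hmono, hadd, hconst]
  exact exp_le_half_integral_add_integral (μ := μ) (S := -(K / 2))
    (T := ((∫ ω, Real.log (f ω) ∂μ) - ∫ ω, Real.log (g ω) ∂μ) / 2)
    (fun ω => Real.exp_pos _) (fun ω => Real.exp_pos _) hfm hgm hlf hlg
    (by linarith) (by linarith)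

end SpinWave

section Packaged

variable {Ω : Type*} [MeasurableSpace Ω] {μ : Measure Ω} [IsProbabilityMeasure μ]
variable {E F : Type*} [NormedAddCommGroup E] [InnerProductSpace ℝ E]
  [NormedAddCommGroup F] [InnerProductSpace ℝ F]

/-- **Spin-wave bound for a semiconcave action.** If `x ↦ C/2 ‖L x‖² - A x` is convex then for
every disorder shift `e`, every random configuration `u` and every probability law,
`exp(-C ‖L e‖²/2) ≤ (⟨e^{-(A(u-e)-A(u))}⟩ + ⟨e^{-(A(u+e)-A(u))}⟩)/2`. For the Villain action
(`A = ‖·‖²/2β`, `L = id`, `C = 1/β`) this is the Gaussian value `exp(-‖e‖²/2β)`. -/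
theorem exp_neg_half_curv_le_half_integral_add (A : E → ℝ) (L : E →ₗ[ℝ] F) (C : ℝ)
    (hA : ConvexOn ℝ Set.univ (fun x => C / 2 * ‖L x‖ ^ 2 - A x)) (u : Ω → E) (e : E)
    (hfm : Integrable (fun ω => Real.exp (-(A (u ω - e) - A (u ω)))) μ)
    (hgm : Integrable (fun ω => Real.exp (-(A (u ω + e) - A (u ω)))) μ)
    (hf : Integrable (fun ω => -(A (u ω - e) - A (u ω))) μ)
    (hg : Integrable (fun ω => -(A (u ω + e) - A (u ω))) μ) :
    Real.exp (-(C * ‖L e‖ ^ 2 / 2)) ≤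
      ((∫ ω, Real.exp (-(A (u ω - e) - A (u ω))) ∂μ)
        + ∫ ω, Real.exp (-(A (u ω + e) - A (u ω))) ∂μ) / 2 := by
  have h := exp_neg_half_le_half_integral_add_of_second_diff_le (μ := μ) A e (C * ‖L e‖ ^ 2)
    (fun v => second_diff_le_of_convexOn A L C hA v e) u hfm hgm hf hg
  simpa [div_eq_mul_inv, mul_comm] using h

/-- **Cell-wise spin-wave bound.** For a finite family of cells `i ∈ s` with local actions `A i`
of curvature at most `C i` along `L i`, the total action `∑ A i` obeys the symmetrised spin-wave
bound with constant `∑ C i ‖L i e‖²` — the quasi-local, non-product replacement for the Gaussian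
`‖E_S‖²/β` of the Villain model. -/
theorem exp_neg_half_sum_curv_le_half_integral_add {ι : Type*} (s : Finset ι) (A : ι → E → ℝ)
    (L : ι → (E →ₗ[ℝ] F)) (C : ι → ℝ)
    (hA : ∀ i ∈ s, ConvexOn ℝ Set.univ (fun x => C i / 2 * ‖L i x‖ ^ 2 - A i x))
    (u : Ω → E) (e : E)
    (hfm : Integrable (fun ω => Real.exp (-((∑ i ∈ s, A i (u ω - e)) - ∑ i ∈ s, A i (u ω)))) μ)
    (hgm : Integrable (fun ω => Real.exp (-((∑ i ∈ s, A i (u ω + e)) - ∑ i ∈ s, A i (u ω)))) μ)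
    (hf : Integrable (fun ω => -((∑ i ∈ s, A i (u ω - e)) - ∑ i ∈ s, A i (u ω))) μ)
    (hg : Integrable (fun ω => -((∑ i ∈ s, A i (u ω + e)) - ∑ i ∈ s, A i (u ω))) μ) :
    Real.exp (-((∑ i ∈ s, C i * ‖L i e‖ ^ 2) / 2)) ≤
      ((∫ ω, Real.exp (-((∑ i ∈ s, A i (u ω - e)) - ∑ i ∈ s, A i (u ω))) ∂μ)
        + ∫ ω, Real.exp (-((∑ i ∈ s, A i (u ω + e)) - ∑ i ∈ s, A i (u ω))) ∂μ) / 2 := by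
  have hK : ∀ v, (fun x => ∑ i ∈ s, A i x) (v + e) + (fun x => ∑ i ∈ s, A i x) (v - e)
      - 2 * (fun x => ∑ i ∈ s, A i x) v ≤ ∑ i ∈ s, C i * ‖L i e‖ ^ 2 :=
    fun v => sum_second_diff_le s A L C hA v e
  exact exp_neg_half_le_half_integral_add_of_second_diff_le (μ := μ) (fun x => ∑ i ∈ s, A i x) e
    (∑ i ∈ s, C i * ‖L i e‖ ^ 2) hK u hfm hgm hf hg

end Packaged

end Summit.AtomisticToContinuum.BoseEinsteinCondensation.Theorems
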